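import Summits.Langlands.Langlands.Theorems.PhantomRMYoshidaResiduallyYoshidaLiftingGreenbergSelmerVocabulary
import Summits.Langlands.Langlands.Theorems.PhantomRMYoshidaResiduallyYoshidaLiftingRibetNonsplitLattice
import Summits.Langlands.Langlands.Theorems.PhantomRMYoshidaResiduallyYoshidaLiftingRibetRealisation
import Summits.Langlands.Langlands.Theorems.PhantomRMYoshidaResiduallyYoshidaLiftingRealisedClassesDual
import Summits.Langlands.Langlands.Theorems.PhantomRMYoshidaResiduallyYoshidaLiftingKlingenReduction
import HarnessLib

/-!
# THE RANK-ONE REDUCTION of line `sector-klingen-split` (stubs `stub_anchorRealises_of_rankLeOne` KV2',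
# `stub_rankOneReduction` RR, `stub_isRealisedThrough_dual` KV4) — crux `ResiduallyYoshidaLifting` (stmt-Langlands-13639)

Lead prover-line-stmt-Langlands-13639-c5-0 (continuation c5, cycle 4, skeleton rev 16, 2026-08-17).

On an admissible fibre (`σ̄, σ̄'` irreducible, non-conjugate, `DetC`, `p ≠ 2`) whose Greenberg–Selmer space with ramification inside
`S` has rank at most one (`GreenbergSelmerRankLeOne`, Theorems/…GreenbergSelmerDefs, p170860):
* KV2' — the crux's anchor `ρ₀` (irreducible, `Sh`, unramified outside `S`) REALISES every non-trivial class realised by an `Sh`-point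
  unramified outside `S`: Ribet R1a for `ρ₀` (p142340), KV1 for both realisers (p171111), rank one, and "realisation depends only on
  the projective class" (`Ribet.realises_smul_add_coboundary`, p140957);
* RR — hence the relative sub-crux on such a fibre follows from NON-SPLIT RELATIVE LIFTING alone ("`ρ₀` and `r` realise the same
  non-trivial class, `Aut ρ₀` ⇒ `r` is a Klingen classical limit", the `c = 1` specialisation of the propagation stub R1d-rel): the anchor
  stub R1c-rel is ELIMINATED on the Berger–Klosin sub-sector;
* KV4 — D3 (p169383) over the vocabulary: a symplectic realiser of `B` realises the adjugate-dual class in the opposite orientation,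
  and that class is non-trivial.
No new definitions, no named fact taken as a hypothesis.
-/

noncomputable section

-- `Summit.Langlands.Langlands.…` (summit = sub-problem name, D-0017 layout) trips `dupNamespace` on every decl.
set_option linter.dupNamespace false
set_option autoImplicit false

open IsDedekindDomain Filter
open scoped Matrix
open Literature.NumberTheory.GaloisRepresentations Literature.NumberTheory.Automorphic
open Summit.Langlands.Langlands.Cruxes.ResiduallyYoshidaLifting.YoshidaDivisorSelmerCount

namespace Summit.Langlands.Langlands.Cruxes.ResiduallyYoshidaLifting.SectorKlingenSplit.Fibre

/-- **Registered sub-goal KV2' `stub_anchorRealises_of_rankLeOne`** (skeleton rev 16): on an admissible fibre whose Greenberg–Selmer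
space with ramification inside `S` has rank at most one, the anchor `ρ₀` realises every non-trivial class realised by an `Sh`-point
unramified outside `S` (Ribet R1a for `ρ₀` + KV1 ×2 + rank one + realisation depends only on the projective class). [folklore] -/
theorem stub_anchorRealises_of_rankLeOne :
    ∀ (p : ℕ) [Fact p.Prime], p ≠ 2 → ∀ (k : Type) [Field k] [CharP k p] [IsAlgClosed k]
      [TopologicalSpace k] [DiscreteTopology k] (red : Valued.integer (PadicAlgCl p) →+* k)
      (σ σ' : FramedGaloisRep ℚ k 2) (ρ₀ ρ : FramedGaloisRep ℚ (PadicAlgCl p) 4)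
      (B : Field.absoluteGaloisGroup ℚ → Matrix (Fin 2) (Fin 2) k)
      (S : Set (HeightOneSpectrum (NumberField.RingOfIntegers ℚ))),
      σ.toGaloisRep.IsIrreducible → σ'.toGaloisRep.IsIrreducible → DetC p k σ σ' →
      (¬ ∃ g : GL (Fin 2) k, ∀ x, g * σ x * g⁻¹ = σ' x) →
      ρ₀.toGaloisRep.IsIrreducible → Sh p k red σ σ' ρ₀ →
      ¬ IsCoboundaryFor σ σ' B → Sh p k red σ σ' ρ → IsRealisedThrough p k red σ σ' ρ B →
      (∀ v ∉ S, ρ.IsUnramifiedAt v ∧ ρ₀.IsUnramifiedAt v) → GreenbergSelmerRankLeOne p k σ σ' S →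
      IsRealisedThrough p k red σ σ' ρ₀ B := by
  intro p _ hp k _ _ _ _ _ red σ σ' ρ₀ ρ B S hσ hσ' hdet hnc hρ₀ hSh₀ hB hSh hreal hS hrank
  -- Ribet (R1a) for the anchor: a non-trivial class `B₀` realised by `ρ₀`
  obtain ⟨P₀, rint₀, h₀, B₀, hP₀, hred₀, hB₀⟩ :=
    Ribet.stub_ribetNonsplitLattice p k red σ σ' ρ₀ hσ hσ' hnc hρ₀ hSh₀.2.2
  have hreal₀ : IsRealisedThrough p k red σ σ' ρ₀ B₀ := ⟨P₀, rint₀, h₀, hP₀, hred₀⟩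
  -- both classes are Greenberg–Selmer cocycles with ramification inside `S` (KV1)
  have hgs₀ : IsGreenbergSelmerCocycle p k σ σ' S B₀ :=
    stub_realisedClass_isGreenbergSelmer p hp k red σ σ' ρ₀ B₀ S hdet hSh₀ hreal₀ fun v hv => (hS v hv).2
  have hgs : IsGreenbergSelmerCocycle p k σ σ' S B :=
    stub_realisedClass_isGreenbergSelmer p hp k red σ σ' ρ B S hdet hSh hreal fun v hv => (hS v hv).1
  have hB₀' : ¬ IsCoboundaryFor σ σ' B₀ := fun ⟨X, hX⟩ => hB₀ ⟨X, hX⟩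
  -- rank one: `B = c • B₀ + δX`
  obtain ⟨c, X, hcX⟩ := hrank B₀ B hgs₀ hgs hB₀' hB
  -- realisation depends only on the projective class (p140957)
  obtain ⟨h', hh'⟩ := Ribet.realises_smul_add_coboundary (e := finSumFinEquiv)
    (ρk := fun g => (Matrix.GeneralLinearGroup.map red (rint₀ g)).val)
    (S := fun g => (σ g).val) (S' := fun g => (σ' g).val) B₀ h₀ c X hred₀
  refine ⟨P₀, rint₀, h', hP₀, fun g => ?_⟩
  rw [hcX g]
  exact hh' g

/-- **Registered sub-goal RR `stub_rankOneReduction`** (skeleton rev 16; THE RANK-ONE REDUCTION): on an admissible fibre carrying the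
anchor `ρ₀`, if the Greenberg–Selmer space with ramification inside `S` has rank at most one, the relative sub-crux for an irreducible
`Sh`-point `ρ` unramified outside `S` follows from non-split relative lifting alone (`ρ₀`, `r` realise the same non-trivial class,
`Aut ρ₀` ⇒ `KLim r`): Ribet R1a for `ρ`, KV2', then the lifting hypothesis. [folklore] -/
theorem stub_rankOneReduction :
    ∀ (p : ℕ) [Fact p.Prime], p ≠ 2 → ∀ (k : Type) [Field k] [CharP k p] [IsAlgClosed k]
      [TopologicalSpace k] [DiscreteTopology k] (red : Valued.integer (PadicAlgCl p) →+* k)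
      (σ σ' : FramedGaloisRep ℚ k 2) (hcpt : isCompact_glFiniteIntegralLevel 4 ℚ) (ι : PadicAlgCl p ≃+* ℂ)
      (ρ₀ ρ : FramedGaloisRep ℚ (PadicAlgCl p) 4) (S : Set (HeightOneSpectrum (NumberField.RingOfIntegers ℚ))),
      (∀ (r : FramedGaloisRep ℚ (PadicAlgCl p) 4) (A : Field.absoluteGaloisGroup ℚ → Matrix (Fin 2) (Fin 2) k),
        ¬ IsCoboundaryFor σ σ' A → r.toGaloisRep.IsIrreducible → Sh p k red σ σ' r →
        IsRealisedThrough p k red σ σ' ρ₀ A → IsRealisedThrough p k red σ σ' r A →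
        IsKlingenClassicalLimit p hcpt ι r) →
      σ.toGaloisRep.IsIrreducible → σ'.toGaloisRep.IsIrreducible → DetC p k σ σ' →
      (¬ ∃ g : GL (Fin 2) k, ∀ x, g * σ x * g⁻¹ = σ' x) →
      ρ₀.toGaloisRep.IsIrreducible → Sh p k red σ σ' ρ₀ → Aut p hcpt ι ρ₀ →
      ρ.toGaloisRep.IsIrreducible → Sh p k red σ σ' ρ →
      (∀ v ∉ S, ρ.IsUnramifiedAt v ∧ ρ₀.IsUnramifiedAt v) → GreenbergSelmerRankLeOne p k σ σ' S →
      IsKlingenClassicalLimit p hcpt ι ρ := by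
  intro p _ hp k _ _ _ _ _ red σ σ' hcpt ι ρ₀ ρ S hL hσ hσ' hdet hnc hρ₀ hSh₀ _hA₀ hρ hSh hS hrank
  -- Ribet (R1a) for `ρ`: a non-trivial class `B` realised by `ρ`
  obtain ⟨P, rint, h, B, hP, hred, hB⟩ := Ribet.stub_ribetNonsplitLattice p k red σ σ' ρ hσ hσ' hnc hρ hSh.2.2
  have hreal : IsRealisedThrough p k red σ σ' ρ B := ⟨P, rint, h, hP, hred⟩
  have hB' : ¬ IsCoboundaryFor σ σ' B := fun ⟨X, hX⟩ => hB ⟨X, hX⟩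
  -- the anchor realises the same class (KV2')
  have hreal₀ : IsRealisedThrough p k red σ σ' ρ₀ B :=
    stub_anchorRealises_of_rankLeOne p hp k red σ σ' ρ₀ ρ B S hσ hσ' hdet hnc hρ₀ hSh₀ hB' hSh hreal hS hrank
  exact hL ρ B hB' hρ hSh hreal₀ hreal

/-- **Registered sub-goal KV4 `stub_isRealisedThrough_dual`** (skeleton rev 16; D3 over the vocabulary): a symplectic realiser of a
non-trivial class `B` of a non-twist pair with equal determinants realises the adjugate-dual class in the opposite orientation, and that
class is non-trivial there. [folklore] -/
theorem stub_isRealisedThrough_dual :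
    ∀ (p : ℕ) [Fact p.Prime], p ≠ 2 → ∀ (k : Type) [Field k] [CharP k p] [IsAlgClosed k]
      [TopologicalSpace k] [DiscreteTopology k] (red : Valued.integer (PadicAlgCl p) →+* k)
      (σ σ' : FramedGaloisRep ℚ k 2) (ρ : FramedGaloisRep ℚ (PadicAlgCl p) 4)
      (B : Field.absoluteGaloisGroup ℚ → Matrix (Fin 2) (Fin 2) k) (ν : Field.absoluteGaloisGroup ℚ → PadicAlgCl p),
      σ.toGaloisRep.IsIrreducible → σ'.toGaloisRep.IsIrreducible →
      (∀ x, (σ' x).val.det = (σ x).val.det) →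
      (¬ ∃ g : GL (Fin 2) k, ∀ x, ∃ c : k, (g * σ x * g⁻¹).val = c • (σ' x).val) →
      ¬ IsCoboundaryFor σ σ' B → ρ.IsSymplecticWithMultiplierFun ν → IsRealisedThrough p k red σ σ' ρ B →
      IsRealisedThrough p k red σ' σ ρ
          (fun g => -(((Matrix.GeneralLinearGroup.det (σ g))⁻¹ : kˣ) : k) • ((σ' g).val * (B g).adjugate * (σ g).val)) ∧
        ¬ IsCoboundaryFor σ' σ
          (fun g => -(((Matrix.GeneralLinearGroup.det (σ g))⁻¹ : kˣ) : k) • ((σ' g).val * (B g).adjugate * (σ g).val)) := by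
  intro p _ hp k _ _ _ _ _ red σ σ' ρ B ν hσ hσ' hdet hnt hB hsymp hreal
  have hB' : ¬ ∃ X : Matrix (Fin 2) (Fin 2) k, ∀ g, B g = (σ g).val * X - X * (σ' g).val := fun ⟨X, hX⟩ => hB ⟨X, hX⟩
  obtain ⟨P, rint, h, hP, hred⟩ := hreal
  obtain ⟨hdual, hnt', -⟩ :=
    stub_realisedClassesDual p hp k red σ σ' ρ B ν hσ hσ' hdet hnt hB' hsymp ⟨P, rint, h, hP, hred⟩
  obtain ⟨P₂, rint₂, h₂, hP₂, hred₂⟩ := hdual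
  exact ⟨⟨P₂, rint₂, h₂, hP₂, hred₂⟩, fun ⟨X, hX⟩ => hnt' ⟨X, hX⟩⟩

end Summit.Langlands.Langlands.Cruxes.ResiduallyYoshidaLifting.SectorKlingenSplit.Fibre

end
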